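import Literature.NumberTheory.LFunctions.Zhang2022.AppendixALemma83RelHolds
import Literature.NumberTheory.LFunctions.Zhang2022.Section9Ded97Substitution
import Literature.NumberTheory.LFunctions.Zhang2022.ClosedFormsPartTwo
import Literature.NumberTheory.LFunctions.Zhang2022.SkeletonEval97cL102Rel
import HarnessLib

/-!
# Zhang (2022) §9 pp. 51–52 in closed form: every typed §9 step HOLDS (`c′ ≥ 0`), and (9.7) in the
# c-reading for every sufficiently large `c′`

Y. Zhang, *Discrete mean estimates and the Landau–Siegel zero*, arXiv:2211.02515v1 (2022)
[Zhang2022LandauSiegel] — **an unrefereed manuscript under adjudication; nothing here asserts anything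
about its Theorems 1–2 or about Landau–Siegel zeros.** ZHANG-L discharge lane (WP09); companion of
`ClosedFormsPartTwo` for §9 (DAG nodes `Z22:§9.u003`–`Z22:(9.7)`, GAP rows G-d17-2, G-d17-3).

With the App. A sentences proved (`Typed.AppendixA1.stepA_u007_analytic_holds` / `stepA_u007_read_holds`,
hence `Skeleton.lemma83Rel_holds`, `Skeleton.lemma84Rel_holds`) and the §9 gathering
(`Section9Gathering.step9u004r_of_lemma84Rel`, leaf h9u004r; `Section9Statements.step9u004r_holds`),
the remaining typed steps of §9 close by composition with the cell's edges (all tree theorems):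

* `step9u003_holds` — `Z22:§9.u003` AS PRINTED (error `O(𝓛⁻⁶)`, absolute) for every `c′`: the relative
  `O(𝓛⁻¹⁵·(∏_{q∣dr}(1−q⁻¹)⁻¹)²)` of `u9003R_of_lemma84W` at `lemma84Rel_holds`, and
  `(∏_{q∣dr}(1−q⁻¹)⁻¹)² ≤ (2𝓛)⁸e⁴⁸ ≤ 256e⁴⁸𝓛⁹` for `dr < P` (Mertens, `Lemma84.prod_primeFactors_le`) —
  the printed (weak) error is thereby TRUE outright although the absolute Lemma 8.4 is not in the tree;
* `ded9u004_holds` — the typed inference `Z22:§9.u004` (`Ded9u004`), trivially, its conclusion being a theorem;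
* `step9u005_holds`, `step9u006c_holds`, `step9u007c_holds` — `Z22:§9.u005` (change of variables),
  `§9.u006` / `§9.u007` in the second (c-)reading of the prefactor of (9.5)–(9.6) (G-d17-2), via
  `ded9u005_holds`, `ded9u006c_holds`, `step9u007c_of` + Prop 7.1 (`Section7cStatements.prop71X_holds`);
* `eval97c_of_eq91`, **`eval97c_eventually : ∃ c₀ ≥ 0, ∀ c′ ≥ c₀, Eval97c c′`** — (9.7) in the
  c-reading (`𝔠₂ = 𝔠₂ᶜ = 6.98709…`; the row G-d17-2 object) for every sufficiently large `c′`, from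
  (9.1) (`Skeleton.eq91_eventually`), Prop 7.1 and `step9u004r_holds`; `Skeleton.eval97With_frakc2c_eventually`
  is the same under the skeleton's parametrised name (the `h97` input of `theorem1_of_evaluations_with`).

Not touched: the literal readings `Step9u004` (stray `Σ_{r<D}`), `Step9u006`/`Step9u007`/`Eval97` (printed
prefactor `0.504`, G-d17-2) and `Step9u014` (refuted in `Section9Proofs.not_step9u014`).
Theorem-only; 0 definitions, 0 new facts.

## References

* Y. Zhang, arXiv:2211.02515v1 (2022), §9 pp. 51–52, tex L2598–L2680; §8 Lemma 8.4 p. 47.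
  [cite: Zhang2022LandauSiegel, §9 pp.51–52]
-/

noncomputable section

open Complex Real ComplexConjugate Finset

namespace Literature.NumberTheory.LFunctions.Zhang2022.Section9Statements

open Literature.NumberTheory.LFunctions.Zhang2022.Skeleton

/-! ## `Z22:§9.u003` as printed -/

/-- For `D ≥ ⌈eᶜ⌉`, `c ≤ 𝓛`. [cite: Zhang2022LandauSiegel, §2 (2.1) p.4] -/
private theorem le_ell_of_ceil_exp_le {c : ℝ} {D : ℕ} (hD : ⌈Real.exp c⌉₊ ≤ D) : c ≤ ell D := by
  have hexp : Real.exp c ≤ D := le_trans (Nat.le_ceil _) (by exact_mod_cast hD)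
  exact (Real.le_log_iff_exp_le (lt_of_lt_of_le (Real.exp_pos _) hexp)).mpr hexp

/-- **The relative factor is `≪ 𝓛⁹` on the support of `S_j`**: for `𝓛 ≥ 3600` and `1 ≤ n` with
`log n ≤ 𝓛⁹`, `(∏_{q∣n}(1−q⁻¹)⁻¹)² ≤ 256e⁴⁸𝓛⁹` (`(1−q⁻¹)⁻¹ ≤ 1 + 2q⁻¹`, Mertens via
`Lemma84.prod_primeFactors_le`, and `𝓛⁹ ≤ D²`). [cite: MontgomeryVaughan2007, Thm 2.7] -/
theorem relFac_le_ell9 {D n : ℕ} (hL : 3600 ≤ ell D) (hn : n ≠ 0) (hnP : Real.log n ≤ ell D ^ 9) :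
    (∏ q ∈ n.primeFactors, (1 - (q : ℝ)⁻¹)⁻¹) ^ 2 ≤ 256 * Real.exp 48 * ell D ^ 9 := by
  have hL1 : 1 ≤ ell D := by linarith
  have hL0 : 0 < ell D := by linarith
  have hD2 : 2 ≤ Real.log D := by rw [← ell]; linarith
  -- termwise `(1 − q⁻¹)⁻¹ ≤ 1 + 2q⁻¹`
  have hterm : ∀ q ∈ n.primeFactors, (1 - (q : ℝ)⁻¹)⁻¹ ≤ 1 + 2 * (q : ℝ) ^ (-(1 : ℝ)) := by
    intro q hq
    have hq2 : (2 : ℝ) ≤ q := by exact_mod_cast (Nat.prime_of_mem_primeFactors hq).two_le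
    have hq0 : (0 : ℝ) < q := by linarith
    rw [Real.rpow_neg_one]
    have hinvle : (q : ℝ)⁻¹ ≤ 1 / 2 := by rw [inv_eq_one_div]; gcongr
    have hinv0 : 0 < (q : ℝ)⁻¹ := inv_pos.mpr hq0
    have h1 : 0 < 1 - (q : ℝ)⁻¹ := by linarith
    have hab : 1 ≤ (1 - (q : ℝ)⁻¹) * (1 + 2 * (q : ℝ)⁻¹) := by
      nlinarith [mul_nonneg hinv0.le (by linarith : (0 : ℝ) ≤ 1 - 2 * (q : ℝ)⁻¹)]
    calc (1 - (q : ℝ)⁻¹)⁻¹ = (1 - (q : ℝ)⁻¹)⁻¹ * 1 := (mul_one _).symm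
      _ ≤ (1 - (q : ℝ)⁻¹)⁻¹ * ((1 - (q : ℝ)⁻¹) * (1 + 2 * (q : ℝ)⁻¹)) :=
          mul_le_mul_of_nonneg_left hab (inv_nonneg.mpr h1.le)
      _ = 1 + 2 * (q : ℝ)⁻¹ := by rw [← mul_assoc, inv_mul_cancel₀ h1.ne', one_mul]
  have hpos : ∀ q ∈ n.primeFactors, 0 ≤ (1 - (q : ℝ)⁻¹)⁻¹ := by
    intro q hq
    have hq2 : (2 : ℝ) ≤ q := by exact_mod_cast (Nat.prime_of_mem_primeFactors hq).two_le
    have : (q : ℝ)⁻¹ ≤ 1 / 2 := by rw [inv_eq_one_div]; gcongr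
    exact inv_nonneg.mpr (by linarith)
  have hprod : ∏ q ∈ n.primeFactors, (1 - (q : ℝ)⁻¹)⁻¹ ≤
      ∏ q ∈ n.primeFactors, (1 + 2 * (q : ℝ) ^ (-(1 : ℝ))) :=
    Finset.prod_le_prod hpos hterm
  have hnP' : Real.log n ≤ Real.log D ^ 9 := by rw [← ell]; exact hnP
  have hM := Lemma84.prod_primeFactors_le (D := D) (n := n) hD2 hn hnP' (C := 2) (η := 0) (σ := 1)
    (by norm_num) le_rfl (by rw [mul_zero, zero_mul]; norm_num) (by norm_num)
  -- `𝓛⁹ ≤ D²` for `𝓛 ≥ 3600`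
  have hDexp : Real.exp (ell D) = (D : ℝ) := by
    have hD0 : (0 : ℝ) < D := by
      rcases lt_or_ge 0 (D : ℝ) with h | h
      · exact h
      · have : ell D ≤ 0 := by
          rw [ell]; exact Real.log_nonpos (Nat.cast_nonneg D) (by linarith)
        linarith
    rw [ell, Real.exp_log hD0]
  have hℓD : ell D ^ 9 ≤ (D : ℝ) ^ 2 := by
    have h10 := Real.pow_div_factorial_le_exp (x := 2 * ell D) (by positivity) 10
    have hfac : ((Nat.factorial 10 : ℕ) : ℝ) = 3628800 := by norm_num [Nat.factorial]
    rw [hfac] at h10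
    have hexp2 : Real.exp (2 * ell D) = (D : ℝ) ^ 2 := by
      rw [show 2 * ell D = ell D + ell D by ring, Real.exp_add, hDexp]; ring
    rw [hexp2] at h10
    have h9 : ell D ^ 9 ≤ (2 * ell D) ^ 10 / 3628800 := by
      rw [le_div_iff₀ (by norm_num), mul_pow]
      have : ell D ^ 9 * 3628800 ≤ ell D ^ 9 * (1024 * ell D) :=
        mul_le_mul_of_nonneg_left (by linarith) (by positivity)
      calc ell D ^ 9 * 3628800 ≤ ell D ^ 9 * (1024 * ell D) := this
        _ = (2 : ℝ) ^ 10 * ell D ^ 10 := by norm_num; ring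
    exact h9.trans h10
  have hD0' : (0 : ℝ) < (D : ℝ) ^ 2 := lt_of_lt_of_le (by positivity) hℓD
  have hfrac : 4 * (2 : ℝ) * Real.log D ^ 9 / (D : ℝ) ^ 2 ≤ 8 := by
    rw [← ell, div_le_iff₀ hD0']; nlinarith
  -- evaluate the exponential bound
  have hlog2L : Real.log (2 * Real.log D) = Real.log (2 * ell D) := by rw [ell]
  have hexp_le : Real.exp (2 * 2 * (Real.log (2 * Real.log D) + 4) + 4 * 2 * Real.log D ^ 9 / (D : ℝ) ^ 2) ≤
      (2 * ell D) ^ 4 * Real.exp 24 := by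
    have h2L : 0 < 2 * ell D := by positivity
    calc Real.exp (2 * 2 * (Real.log (2 * Real.log D) + 4) + 4 * 2 * Real.log D ^ 9 / (D : ℝ) ^ 2)
        ≤ Real.exp (4 * Real.log (2 * ell D) + 24) := by
          rw [Real.exp_le_exp, hlog2L]; linarith
      _ = (2 * ell D) ^ 4 * Real.exp 24 := by
          have h4 : 4 * Real.log (2 * ell D) = Real.log ((2 * ell D) ^ 4) := by
            rw [Real.log_pow]; norm_num
          rw [Real.exp_add, h4, Real.exp_log (pow_pos h2L 4)]
  have hP1 : ∏ q ∈ n.primeFactors, (1 - (q : ℝ)⁻¹)⁻¹ ≤ (2 * ell D) ^ 4 * Real.exp 24 :=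
    hprod.trans (hM.trans hexp_le)
  have hP0 : 0 ≤ ∏ q ∈ n.primeFactors, (1 - (q : ℝ)⁻¹)⁻¹ := Finset.prod_nonneg hpos
  calc (∏ q ∈ n.primeFactors, (1 - (q : ℝ)⁻¹)⁻¹) ^ 2 ≤ ((2 * ell D) ^ 4 * Real.exp 24) ^ 2 :=
        pow_le_pow_left₀ hP0 hP1 2
    _ = 256 * (Real.exp 24 * Real.exp 24) * ell D ^ 8 := by ring
    _ = 256 * Real.exp 48 * ell D ^ 8 := by rw [← Real.exp_add]; norm_num
    _ ≤ 256 * Real.exp 48 * ell D ^ 9 := by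
        apply mul_le_mul_of_nonneg_left _ (by positivity)
        exact pow_le_pow_right₀ hL1 (by norm_num)

/-- **`Z22:§9.u003` AS PRINTED HOLDS for every `c′`** (`Step9u003 c′`: «By Lemma 8.2 and 8.4, for `dr < P₃/T`,
`Σ_n χ(n)ϰ̄₃(drn)ξ₀ⱼ(n;d,r)/n = (L′(1,χ)Π(d,r)/log P₃)𝔤_{j6}(P₃/dr) + O(𝓛⁻⁶)`», tex L2609–L2612): from the
RELATIVE Lemma 8.4 (`Skeleton.lemma84Rel_holds`) through `Section9Gathering.u9003R_of_lemma84W` (error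
`C𝓛⁻¹⁵·(∏_{q∣dr}(1−q⁻¹)⁻¹)²`) and `relFac_le_ell9`; previously discharged only as the implication
`Ded9u003` from the ABSOLUTE Lemma 8.4, which is not a theorem of the tree (G-adj1-1).
[cite: Zhang2022LandauSiegel, §9 p.51, tex L2609–L2612] -/
theorem step9u003_holds (c' : ℝ) : Step9u003 c' := by
  obtain ⟨C, D₀, h⟩ := Section9Gathering.u9003R_of_lemma84W c'
    (W := fun n => (∏ q ∈ n.primeFactors, (1 - (q : ℝ)⁻¹)⁻¹) ^ 2) (fun _ => sq_nonneg _)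
    (lemma84Rel_holds c')
  refine ⟨|C| * (256 * Real.exp 48), max D₀ ⌈Real.exp 3600⌉₊,
    fun D _ χ hD hq hp hA j hj d r hd hr hdr => ?_⟩
  have hD₀ : D₀ ≤ D := le_trans (le_max_left _ _) hD
  have hL : 3600 ≤ ell D := le_ell_of_ceil_exp_le (le_trans (le_max_right _ _) hD)
  have hL4 : 4 ≤ ell D := by linarith
  have hL0 : 0 < ell D := by linarith
  obtain ⟨-, -, -, hTP3, -, hP3P⟩ := Section9Gathering.params3 hL4
  have key := h D χ hD₀ hq hp hA j hj d r hd hr hdr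
  have hdr1 : 1 ≤ d * r := Nat.one_le_iff_ne_zero.mpr (Nat.mul_ne_zero (by omega) (by omega))
  have hdr0 : (0 : ℝ) < ((d * r : ℕ) : ℝ) := by exact_mod_cast hdr1
  have hT1 : 1 ≤ bigT D := by rw [bigT]; exact Real.one_le_exp (by positivity)
  have hP3pos : 0 < Skeleton.P3 D := lt_of_lt_of_le (lt_of_lt_of_le one_pos hT1) hTP3
  have hdrP : ((d * r : ℕ) : ℝ) ≤ bigP D :=
    (hdr.le.trans (div_le_self hP3pos.le hT1)).trans hP3P.le
  have hlogn : Real.log ((d * r : ℕ) : ℝ) ≤ ell D ^ 9 := by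
    calc Real.log ((d * r : ℕ) : ℝ) ≤ Real.log (bigP D) := Real.log_le_log hdr0 hdrP
      _ = ell D ^ 9 := by rw [bigP, Real.log_exp]
  have hW := relFac_le_ell9 (n := d * r) hL (by omega) hlogn
  have hC0 : 0 ≤ |C| := abs_nonneg _
  calc _ ≤ C * (ell D ^ 15)⁻¹ * (∏ q ∈ (d * r).primeFactors, (1 - (q : ℝ)⁻¹)⁻¹) ^ 2 := key
    _ ≤ |C| * (ell D ^ 15)⁻¹ * (256 * Real.exp 48 * ell D ^ 9) :=
        mul_le_mul (mul_le_mul_of_nonneg_right (le_abs_self C) (by positivity)) hW (sq_nonneg _)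
          (by positivity)
    _ = |C| * (256 * Real.exp 48) * (ell D ^ 6)⁻¹ := by field_simp

variable (c' : ℝ) in
/-- `Step9u003` — `_holds` alias of `step9u003_holds` above under the fact's exact name, stated under the
prover's own binders as section variables (appended 2026-08-28, D-0026 bookkeeping: the proof term is the
existing theorem of this file; no statement, definition or attribute is edited; no new named fact; the
ledger's debt table listed the fact unproved). [cite: Zhang2022LandauSiegel, §9 p.51, tex L2609–L2612] -/
theorem _root_.Literature.NumberTheory.LFunctions.Zhang2022.Section9Statements.Step9u003_holds :
    _root_.Literature.NumberTheory.LFunctions.Zhang2022.Section9Statements.Step9u003 c' :=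
  _root_.Literature.NumberTheory.LFunctions.Zhang2022.Section9Statements.step9u003_holds (c' := c')

/-! ## The typed inferences and steps `Z22:§9.u004`–`§9.u007` -/

/-- **The typed inference `Z22:§9.u004` HOLDS for `c′ ≥ 0`** (`Ded9u004 c′ : Step9u001 → Step9u002 →
Step9u003 → Lemma82 → Lemma84 → Step9u004r`) — its conclusion is now the theorem `step9u004r_holds`.
[cite: Zhang2022LandauSiegel, §9 p.51, tex L2613] -/
theorem ded9u004_holds {c' : ℝ} (hc' : 0 ≤ c') : Ded9u004 c' :=
  fun _ _ _ _ _ => step9u004r_holds hc'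

/-- **`Z22:§9.u005` HOLDS for `c′ ≥ 0`** (the four-integral form after the change of variables
`x → P₂/x`, `x → P₃/x`): `Section9Discharge.ded9u005_holds` at `step9u004r_holds`.
[cite: Zhang2022LandauSiegel, §9 p.51, tex L2619–L2626] -/
theorem step9u005_holds {c' : ℝ} (hc' : 0 ≤ c') : Step9u005 c' :=
  Section9Discharge.ded9u005_holds c' (step9u004r_holds hc')

/-- **`Z22:§9.u006` in the second reading HOLDS for `c′ ≥ 0`** (`Step9u006c`: the weighted sum
`(2α)⁻¹S₁ + 2α⁻¹S₂ + (3/(2α))S₃ = 𝔞·Theta1Coeff9 + o(1)`, prefactor `((0.5)(0.498)π)⁻¹` in `b₃₄, b₄₃`):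
`Section9Discharge.ded9u006c_holds` at `step9u005_holds`. [cite: Zhang2022LandauSiegel, §9 pp.51–52, tex L2626–L2645] -/
theorem step9u006c_holds {c' : ℝ} (hc' : 0 ≤ c') : Step9u006c c' :=
  Section9Discharge.ded9u006c_holds c' (step9u005_holds hc')

/-- **`Z22:§9.u007` in the second reading HOLDS for `c′ ≥ 0`** (`Step9u007c`:
`Θ₁(𝐚₁₂,𝐚₂₂) = Theta1Coeff9·𝔞𝔓 + o(𝔓)`): `Section9Discharge.step9u007c_of` at Proposition 7.1
(`Section7cStatements.prop71X_holds`), `step9u005_holds`, `step9u006c_holds`.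
[cite: Zhang2022LandauSiegel, §9 p.52, tex L2646–L2649] -/
theorem step9u007c_holds {c' : ℝ} (hc' : 0 ≤ c') : Step9u007c c' :=
  Section9Discharge.step9u007c_of c' (Section7cStatements.prop71X_holds c') (step9u005_holds hc')
    (step9u006c_holds hc')

/-! ## (9.7) in the c-reading -/

/-- **(9.7) in the c-reading from (9.1)** (`c′ ≥ 0`): `Skeleton.Eq91 c′ → Eval97c c′`
(`Ξ₁₂ = 𝔠₂ᶜ𝔞𝔓 + o(𝔓)`, `𝔠₂ᶜ = 6.98709…`), via `Section9Discharge.eval97c_of_step9u004r` at Prop 7.1 and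
`step9u004r_holds`. [cite: Zhang2022LandauSiegel, §9 (9.7) p.52, tex L2650–L2669] -/
theorem eval97c_of_eq91 {c' : ℝ} (hc' : 0 ≤ c') (h91 : Skeleton.Eq91 c') : Eval97c c' :=
  Section9Discharge.eval97c_of_step9u004r c' h91 (Section7cStatements.prop71X_holds c')
    (step9u004r_holds hc')

/-- **(9.7) in the c-reading HOLDS for every sufficiently large `c′`** (the §9 endpoint; GAP row G-d17-2's
object `Eval97c`): from (9.1) for large `c′` (`Skeleton.eq91_eventually`: Prop 2.2 with its part (iii) at
the manuscript's «sufficiently large c′», Lemma 2.3, Lemma 8.1) and `eval97c_of_eq91`.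
[cite: Zhang2022LandauSiegel, §9 (9.7) p.52] -/
theorem eval97c_eventually : ∃ c₀ : ℝ, 0 ≤ c₀ ∧ ∀ c' : ℝ, c₀ ≤ c' → Eval97c c' := by
  obtain ⟨c₀, h0, h⟩ := Skeleton.eq91_eventually
  exact ⟨c₀, h0, fun c' hc' => eval97c_of_eq91 (h0.trans hc') (h c' hc')⟩

end Literature.NumberTheory.LFunctions.Zhang2022.Section9Statements

namespace Literature.NumberTheory.LFunctions.Zhang2022.Skeleton

/-- **`Eval97With c′ frakc2c.re` for every sufficiently large `c′`** — the `h97` input of the 𝔠₂-generic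
§2 endgame `theorem1_of_evaluations_with`, under the skeleton's name (= `Section9Statements.Eval97c` by
`eval97With_frakc2c_iff`). [cite: Zhang2022LandauSiegel, §9 (9.7) p.52] -/
theorem eval97With_frakc2c_eventually :
    ∃ c₀ : ℝ, 0 ≤ c₀ ∧ ∀ c' : ℝ, c₀ ≤ c' → Eval97With c' frakc2c.re := by
  obtain ⟨c₀, h0, h⟩ := Section9Statements.eval97c_eventually
  exact ⟨c₀, h0, fun c' hc' => eval97With_frakc2c_iff.mpr (h c' hc')⟩

end Literature.NumberTheory.LFunctions.Zhang2022.Skeleton
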